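import Mathlib.LinearAlgebra.TensorProduct.Tower
import Mathlib.LinearAlgebra.Dimension.Finrank
import Mathlib.FieldTheory.IntermediateField.Basic
import Mathlib.NumberTheory.Padics.PadicNumbers
import Mathlib.RepresentationTheory.Invariants
import Literature.NumberTheory.GaloisRepresentations.GaloisRep
import HarnessLib

-- provenance: harness21/H21/H21/Prelude/GalRep/PAdicHodge.lean @ 08f99a0 (interim HEAD d8f2665); M5 mechanical rewrite
/-!
# `p`-adic Hodge-theoretic conditions (trunk GalRep, item C17 = `G09:PAdicHodge`)

Hypothesis-structure formalisation of Fontaine's period-ring formalism (notion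
`p_adic_hodge_conditions`): de Rham / Hodge–Tate / crystalline / semistable Galois
representations, Hodge–Tate weights, and the Fontaine–Mazur adjective *geometric*.

Mathlib has the period ring `BDeRham` (`Mathlib/RingTheory/Perfectoid/BDeRham.lean`) but with no
Galois action, no filtration and no comparison with a local field, and it has no `B_HT`, `B_cris`,
`B_st` (grep `HodgeTate`, `Crystalline`, `PeriodRing` in Mathlib: nothing).  Following OUTLINE
D10 we therefore do **not** construct period rings; instead a consumer supplies a
`PeriodRingData`, i.e. Fontaine's abstract notion of a *`(P, Γ)`-regular `E`-algebra* `B`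
(Fontaine, *Représentations `p`-adiques semi-stables*, Astérisque 223 (1994), Exposé III §1)
together with a `Γ`-stable exhaustive separated multiplicative `ℤ`-filtration, and every
`p`-adic Hodge-theoretic predicate is *relative to* such a datum.  Instantiating the datum with
`B_dR`, `B_HT = ⊕ ℂ_p(i)`, `B_cris`, `B_st` (once available) yields the genuine notions.

## Main definitions

* `Literature.PeriodRingData Γ P E`: for a group `Γ`, a coefficient field `P` (plays `ℚ_p`) and a field
  `E` over `P` (plays `B^Γ`: the `p`-adic field `F` for `B_dR`, `B_HT`; its maximal absolutely
  unramified subfield `F₀` for `B_cris`, `B_st`): an `E`-algebra `B` which is a domain, with a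
  `Γ`-action by `E`-algebra automorphisms, Fontaine's regularity axioms, `B^Γ = E`
  (`invariants_eq`), and a filtration `fil : ℤ → Submodule E B`.  Derived instances on `𝔅.B`:
  `PeriodRingData.instAlgebraP` (`Algebra P 𝔅.B` through `E`), `instIsScalarTower`,
  `instSMulCommClassP`.
* `PeriodRingData.tensorRep 𝔅 ρ`: the diagonal `E`-linear representation of `Γ` on
  `𝔅.B ⊗[P] M` for a `P`-linear continuous representation `ρ : Literature.ContinuousRep Γ P M`;
  `PeriodRingData.D 𝔅 ρ = (B ⊗[P] M)^Γ` (Mathlib `Representation.invariants`), an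
  `E`-submodule; `PeriodRingData.IsAdmissible 𝔅 ρ : finrank E (D 𝔅 ρ) = finrank P M`
  (Fontaine: always `≤`, `PeriodRingData.finrank_D_le`).
* `PeriodRingData.filD 𝔅 ρ i` (the filtration `Fil^i D` induced by `fil i ⊗ M`),
  `PeriodRingData.hodgeTateWeights 𝔅 ρ : Multiset ℤ` (`i` with multiplicity
  `dim Fil^i D - dim Fil^{i+1} D`).
* `Literature.CrystallinePeriodRingData P F`: `F₀ : IntermediateField P F`, a
  `PeriodRingData (Γ_F) P F₀` (so `B^{Γ_F} = F₀`, as for `B_cris`) and a `Γ_F`-equivariant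
  Frobenius `frob : B →ₐ[P] B`; `Literature.SemistablePeriodRingData P F p` adds the monodromy operator
  `N` with `N φ = p φ N`.
* For `ρ : Literature.GaloisRep F P M` (a `P`-linear representation of `Γ_F = Field.absoluteGaloisGroup
  F`): `GaloisRep.IsDeRham 𝔅 ρ`, `GaloisRep.IsHodgeTate 𝔅 ρ` (`𝔅 : PeriodRingData Γ_F P F`),
  `GaloisRep.IsCrystalline`, `GaloisRep.IsSemistable`, `GaloisRep.IsHodgeTateRegular`.
* Global: `GaloisRep.IsGeometric 𝔅 ρ` for `ρ : GaloisRep K ℚ_[ℓ] M`, `K` a number field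
  (Fontaine–Mazur): unramified almost everywhere and de Rham at every `v ∣ ℓ`.

## Design choices

* **The group is a parameter** (`PeriodRingData Γ P E` rather than the outline's
  `PeriodRingData P F` with `Γ = Γ_F` and `E = F`).  Reason: `B_cris` and `B_st` are *not*
  `F`-algebras when `F/F₀` is ramified, only `F₀`-algebras, while the acting group is still
  `Γ_F` and `B_cris^{Γ_F} = F₀`; and Lean structures cannot override a parent field.  With `Γ` and
  `E` decoupled, one structure and one `D`/`filD`/`hodgeTateWeights` API serve all four period
  rings: de Rham/Hodge–Tate use `PeriodRingData (absoluteGaloisGroup F) P F`, crystalline/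
  semistable use `PeriodRingData (absoluteGaloisGroup F) P F₀` bundled with `F₀` and `φ`, `N`.
  `E = F` carries only `[Field F] [Algebra P F]` — no `IsNonarchimedeanLocalField` — so that
  `F = v.adicCompletion K` is allowed (OUTLINE D10).
* **Definitions vs. named facts.** `PeriodRingData.IsAdmissible` (and its aliases
  `GaloisRep.IsDeRham`, `IsHodgeTate`, `IsCrystalline`, `IsSemistable`, `IsHodgeTateRegular`,
  `IsGeometric`) are *definitions* — predicates on a representation relative to a datum, Fontaine's
  Définition of `B`-admissible — and take their subjects as explicit binders: a `def … : Prop`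
  with no explicit parameter is read by the named-fact census (D-0014) as a closed fact awaiting a
  proof `…_holds`, which would here be the false statement `∀ 𝔅 ρ, 𝔅.IsAdmissible ρ`
  (`PeriodRingData.not_forall_isAdmissible`, file `PAdicHodgeBaseDatum`).  The one genuine named
  fact of this file, `PeriodRingData.finrank_D_le` (Fontaine's inequality), keeps the section
  variables: its closure over `(𝔅, ρ)` is the cited theorem, proved as
  `PeriodRingData.finrank_D_le_holds` in `PAdicHodgeProofs`.
* **Fontaine regularity is part of the datum** (`isDomain`, `exists_smul_eq`,
  `isUnit_of_smul_mem`, `invariants_eq`): these are exactly the hypotheses under which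
  `dim_E D(V) ≤ dim_P V` with equality iff the comparison map is an isomorphism (Fontaine,
  Exposé III, Prop. 1.4.2, Thm. 1.5.2), which is what makes `IsAdmissible` the faithful notion.
* `Algebra P 𝔅.B` is *derived* (`((algebraMap E B).comp (algebraMap P E)).toAlgebra`), as are
  `IsScalarTower P E 𝔅.B` and `SMulCommClass Γ P 𝔅.B`; the `E`-module structure on
  `𝔅.B ⊗[P] M` is Mathlib's `TensorProduct.leftModule`, and the diagonal action is built with
  `TensorProduct.AlgebraTensorModule.map` (so `E`-linearity of `D` is by construction).
* **Hodge–Tate weights convention.** `i` occurs with multiplicity `dim_E gr^i D`; with `B_dR`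
  this makes the cyclotomic character have weight `-1` (Buzzard–Gee, *The conjectural connections
  between automorphic representations and Galois representations* (2014), §2.2 / Def. 3.1.1
  footnote).  If the set of jumps is infinite (impossible for finite-dimensional `D`, but not
  excluded by the types) the junk value `0` is returned (documented on the definition).
* **Coefficients.** For coefficients in a finite extension `E'/ℚ_p`, apply the predicates to the
  `ℚ_p`-restriction of scalars of `ρ` (Fontaine's formalism is `ℚ_p`-linear; Buzzard–Gee 2014,
  §2.2), i.e. instantiate `P := ℚ_[p]` and `M` with its `Module ℚ_[p]` structure.
* **Global `IsGeometric`.** Mathlib has no `Algebra ℚ_[ℓ] (v.adicCompletion K)` instance for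
  `v ∣ ℓ`; the datum supplied at each `v ∣ ℓ` is therefore a dependent pair
  `Σ' (_ : Algebra ℚ_[ℓ] K_v), PeriodRingData Γ_{K_v} ℚ_[ℓ] K_v`.
* **Topology-on-`M` rule (OUTLINE D1).** All predicates here take `[TopologicalSpace M]` as data
  through `GaloisRep F P M` and depend only on the underlying representation; consumers
  (lang.S34/S35/S03, hodge.S27) must instantiate with `[IsModuleTopology ℚ_[ℓ] M]` or use framed
  representations (`FramedGaloisRep.toGaloisRep`).

## References

* J.-M. Fontaine, *Le corps des périodes `p`-adiques* and *Représentations `p`-adiques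
  semi-stables*, Astérisque 223 (1994), Exposés II, III (§1 `B`-admissible representations,
  §1.4 regular algebras, §1.5 `D_B`, Hodge–Tate/de Rham/crystalline/semistable).
* J.-M. Fontaine, B. Mazur, *Geometric Galois representations* (1995), §1 (Conjecture 1,
  "geometric = unramified a.e. + potentially semistable (= de Rham) at `p`").
* K. Buzzard, T. Gee, *The conjectural connections between automorphic representations and Galois
  representations* (2014), §2.2, Def. 3.1.1 (Hodge–Tate weights, regularity).
* Mathlib anchor: `Mathlib/RingTheory/Perfectoid/BDeRham.lean` (`BDeRham`, no action/filtration).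
-/

noncomputable section

open scoped NumberField TensorProduct
open Field IsDedekindDomain TensorProduct

namespace Literature.NumberTheory.GaloisRepresentations

universe u v v' w w'

/-! ### Period-ring data (Fontaine's regular `(P, Γ)`-algebras with a filtration) -/

/-- A **period-ring datum** for the group `Γ`, coefficient field `P` (playing `ℚ_p`) and
invariant field `E ⊇ P` (playing `B^Γ`): a commutative `E`-algebra `B` which is a domain, with an
action of `Γ` by ring automorphisms commuting with `E` (`smulComm`), satisfying Fontaine's
regularity conditions — `B^Γ = E` (`invariants_eq`), `(Frac B)^Γ = B^Γ` in the fraction-free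
form `exists_smul_eq`, and "a nonzero `b` spanning a `Γ`-stable `P`-line is a unit"
(`isUnit_of_smul_mem`) — together with a decreasing, exhaustive, separated, multiplicative,
`Γ`-stable `ℤ`-filtration `fil` by `E`-submodules (for `B_dR`: `Fil^i = t^i B_dR^+`; for the
graded ring `B_HT = ⊕ ℂ_p(i)`: `Fil^i = ⊕_{j ≥ i}`).  Intended instances: `Γ = Γ_F`,
`E = F` for `B_dR`, `B_HT`; `E = F₀` for `B_cris`, `B_st` (see `CrystallinePeriodRingData`).
Ref: Fontaine, *Représentations `p`-adiques semi-stables*, Astérisque 223 (1994), Exposé III,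
§1.4 (regular `(P, Γ)`-rings), Exposé II §1.5, §3 (filtrations on `B_dR`). [folklore] -/
structure PeriodRingData (Γ : Type u) [Group Γ] (P : Type v) (E : Type v') [Field P] [Field E]
    [Algebra P E] : Type (max u v' (w + 1)) where
  /-- The period ring `B`. -/
  B : Type w
  /-- `B` is a commutative ring. -/
  [commRing : CommRing B]
  /-- `B` is a domain (Fontaine's regularity, condition (i)). -/
  [isDomain : IsDomain B]
  /-- `B` is an `E`-algebra. -/
  [algebra : Algebra E B]
  /-- `Γ` acts on `B` by ring automorphisms. -/
  [action : MulSemiringAction Γ B]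
  /-- The action is `E`-linear: `σ • (e • b) = e • σ • b`. -/
  [smulComm : SMulCommClass Γ E B]
  /-- `B^Γ = E`: the `Γ`-invariants are exactly the image of `E`. -/
  invariants_eq : {b : B | ∀ σ : Γ, σ • b = b} = Set.range (algebraMap E B)
  /-- `(Frac B)^Γ = B^Γ`, phrased inside `B`: if `b/c` is `Γ`-invariant then `b ∈ E • c`
  (Fontaine's regularity, condition (ii)). -/
  exists_smul_eq : ∀ b c : B, c ≠ 0 → (∀ σ : Γ, σ • b * c = b * σ • c) → ∃ e : E, b = e • c
  /-- A nonzero `b` such that the `P`-line through `b` is `Γ`-stable is a unit (Fontaine's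
  regularity, condition (iii)). -/
  isUnit_of_smul_mem : ∀ b : B, b ≠ 0 →
    (∀ σ : Γ, ∃ c : P, σ • b = algebraMap E B (algebraMap P E c) * b) → IsUnit b
  /-- The decreasing filtration `Fil^i B`, `i : ℤ`, by `E`-submodules. -/
  fil : ℤ → Submodule E B
  /-- The filtration is decreasing. -/
  fil_antitone : Antitone fil
  /-- The filtration is multiplicative. -/
  mul_mem_fil : ∀ (i j : ℤ) (x y : B), x ∈ fil i → y ∈ fil j → x * y ∈ fil (i + j)
  /-- `1 ∈ Fil^0`. -/
  one_mem_fil_zero : (1 : B) ∈ fil 0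
  /-- Each `Fil^i` is `Γ`-stable. -/
  smul_mem_fil : ∀ (σ : Γ) (i : ℤ) (x : B), x ∈ fil i → σ • x ∈ fil i
  /-- The filtration is exhaustive. -/
  iSup_fil : ⨆ i, fil i = ⊤
  /-- The filtration is separated. -/
  iInf_fil : ⨅ i, fil i = ⊥

namespace PeriodRingData

attribute [instance] commRing isDomain algebra action smulComm

section Instances

variable {Γ : Type u} [Group Γ] {P : Type v} {E : Type v'} [Field P] [Field E] [Algebra P E]
  (𝔅 : PeriodRingData.{u, v, v', w} Γ P E)

/-- The `P`-algebra structure on `𝔅.B` obtained through `P → E → B`.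
Ref: Fontaine, Astérisque 223 (1994), Exposé III §1.3 (`B` is an `E`-algebra, hence a
`ℚ_p`-algebra). [folklore] -/
instance instAlgebraP : Algebra P 𝔅.B :=
  ((algebraMap E 𝔅.B).comp (algebraMap P E)).toAlgebra

/-- Unfolding lemma for `instAlgebraP`. [folklore] -/
lemma algebraMap_eq (c : P) : algebraMap P 𝔅.B c = algebraMap E 𝔅.B (algebraMap P E c) := rfl

/-- `P → E → B` is a scalar tower. [folklore] -/
instance instIsScalarTower : IsScalarTower P E 𝔅.B :=
  IsScalarTower.of_algebraMap_eq fun _ => rfl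

/-- The `Γ`-action on `𝔅.B` is `P`-linear (since it is `E`-linear). [folklore] -/
instance instSMulCommClassP : SMulCommClass Γ P 𝔅.B where
  smul_comm σ c b := by
    rw [← algebraMap_smul (A := E) c b, smul_comm σ, algebraMap_smul]

end Instances

/-! ### The functor `D_B` and admissibility -/

section Admissible

variable {Γ : Type u} [Group Γ] [TopologicalSpace Γ] {P : Type v} {E : Type v'} [Field P]
  [TopologicalSpace P] [Field E] [Algebra P E]
  {M : Type w'} [AddCommGroup M] [Module P M] [TopologicalSpace M]
  (𝔅 : PeriodRingData.{u, v, v', w} Γ P E) (ρ : ContinuousRep Γ P M)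

/-- The diagonal representation `σ ↦ σ ⊗ ρ(σ)` of `Γ` on `B ⊗[P] M`, as an `E`-linear
representation (`E` acting through the left factor, Mathlib `TensorProduct.leftModule`; the map
is `TensorProduct.AlgebraTensorModule.map (σ • ·) (ρ σ)`).  Only the underlying representation of
`ρ` is used.
Ref: Fontaine, Astérisque 223 (1994), Exposé III §1.3. [folklore] -/
def tensorRep : Representation E Γ (𝔅.B ⊗[P] M) where
  toFun σ := AlgebraTensorModule.map (DistribMulAction.toModuleEnd E 𝔅.B σ) (ρ σ)
  map_one' := by
    rw [map_one, map_one]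
    exact AlgebraTensorModule.map_one
  map_mul' σ τ := by
    rw [map_mul, map_mul]
    exact AlgebraTensorModule.map_mul _ _ _ _

/-- Unfolding lemma for `tensorRep` on pure tensors: `σ • (b ⊗ m) = σ b ⊗ ρ(σ) m`. [folklore] -/
@[simp] lemma tensorRep_apply_tmul (σ : Γ) (b : 𝔅.B) (m : M) :
    𝔅.tensorRep ρ σ (b ⊗ₜ m) = (σ • b) ⊗ₜ ρ σ m := rfl

/-- Fontaine's **`D_B(V) = (B ⊗_{ℚ_p} V)^Γ`**, the `E = B^Γ`-vector space of `Γ`-invariants of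
the diagonal action on `𝔅.B ⊗[P] M` (Mathlib `Representation.invariants`).
Ref: Fontaine, Astérisque 223 (1994), Exposé III §1.3, §1.5. [folklore] -/
def D : Submodule E (𝔅.B ⊗[P] M) :=
  (𝔅.tensorRep ρ).invariants

/-- Membership in `D`: invariance under every `σ`. [folklore] -/
lemma mem_D_iff (x : 𝔅.B ⊗[P] M) : x ∈ 𝔅.D ρ ↔ ∀ σ : Γ, 𝔅.tensorRep ρ σ x = x := Iff.rfl

/-- `ρ` is **`B`-admissible**: `dim_E D_B(V) = dim_P V` (Fontaine).  With `B = B_dR`, `B_HT`,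
`B_cris`, `B_st` this is *de Rham*, *Hodge–Tate*, *crystalline*, *semistable*.

This is a DEFINITION — a predicate on the pair `(𝔅, ρ)`, which therefore takes `𝔅` and `ρ` as
explicit binders rather than from the section `variable`s — not a named fact awaiting a proof
`IsAdmissible_holds`: its universal closure `∀ 𝔅 ρ, 𝔅.IsAdmissible ρ` is false
(`PeriodRingData.not_forall_isAdmissible`, file `PAdicHodgeBaseDatum`: for the base datum `B = E`
with trivial `Γ`-action, admissible means that `Γ` acts trivially on `M`,
`PeriodRingData.isAdmissible_trivial_iff`).  The genuine theorem about `D_B` stated in this file is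
Fontaine's inequality `finrank_D_le` (proved in `PAdicHodgeProofs`).
Ref: Fontaine, Astérisque 223 (1994), Exposé III §1.5 (Définition). [folklore] -/
def IsAdmissible (𝔅 : PeriodRingData.{u, v, v', w} Γ P E) (ρ : ContinuousRep Γ P M) : Prop :=
  Module.finrank E (𝔅.D ρ) = Module.finrank P M

/-- **Fontaine's inequality** `dim_E D_B(V) ≤ dim_{ℚ_p} V` for a regular `(P, Γ)`-ring `B`
(the comparison map `B ⊗_E D_B(V) → B ⊗_P V` is injective).
Ref: Fontaine, Astérisque 223 (1994), Exposé III, Prop. 1.4.2 and Thm. 1.5.2. [cite: FontaineAsterisque223III, Prop. 1.4.2 and Thm. 1.5.2] -/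
def finrank_D_le : Prop :=
  ∀ [FiniteDimensional P M],
    Module.finrank E (𝔅.D ρ) ≤ Module.finrank P M

variable (M) in
/-- The image `Fil^i B ⊗ M` of `fil i ⊗[P] M` in `B ⊗[P] M`, as an `E`-submodule
(auxiliary for `filD`). [folklore] -/
def filTensor (i : ℤ) : Submodule E (𝔅.B ⊗[P] M) :=
  LinearMap.range (AlgebraTensorModule.map (𝔅.fil i).subtype (LinearMap.id : M →ₗ[P] M))

/-- The induced filtration **`Fil^i D = D ∩ (Fil^i B ⊗ V)`** on `D_B(V)` (for `B = B_dR` this is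
the Hodge filtration on `D_dR(V)`).
Ref: Fontaine, Astérisque 223 (1994), Exposé III §1.5.4; Exposé II §3. [folklore] -/
def filD (i : ℤ) : Submodule E (𝔅.D ρ) :=
  (𝔅.filTensor M i).comap (𝔅.D ρ).subtype

/-- Membership in `Fil^i D`: the underlying tensor lies in the image of `Fil^i B ⊗ M`. [folklore] -/
lemma mem_filD_iff (i : ℤ) (x : 𝔅.D ρ) : x ∈ 𝔅.filD ρ i ↔ (x : 𝔅.B ⊗[P] M) ∈ 𝔅.filTensor M i :=
  Iff.rfl

/-- The filtration on `D` is decreasing. [folklore] -/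
lemma filD_antitone : Antitone (𝔅.filD ρ) := by
  intro i j hij
  refine Submodule.comap_mono ?_
  rintro x ⟨y, rfl⟩
  refine ⟨AlgebraTensorModule.map (Submodule.inclusion (𝔅.fil_antitone hij)) LinearMap.id y, ?_⟩
  rw [← LinearMap.comp_apply, ← AlgebraTensorModule.map_comp]
  rfl

open scoped Classical in
/-- The **Hodge–Tate weights** of `ρ` relative to `𝔅`: the multiset of integers `i`, each with
multiplicity `dim_E Fil^i D - dim_E Fil^{i+1} D = dim_E gr^i D_B(V)` (natural-number
subtraction is harmless as `filD` is antitone).  Convention: with `B = B_dR` the cyclotomic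
character has Hodge–Tate weight `-1` (Buzzard–Gee).  **Junk value:** if the set of jumps
`{i | dim Fil^{i+1} D < dim Fil^i D}` is infinite (which cannot happen when `D` is finite-
dimensional, e.g. under `finrank_D_le`) the value is `0`.
Ref: Fontaine, Astérisque 223 (1994), Exposé III §1.5; Buzzard–Gee (2014), §2.2. [cite: BuzzardGee2014] -/
def hodgeTateWeights : Multiset ℤ :=
  if h : {i : ℤ | Module.finrank E (𝔅.filD ρ (i + 1)) < Module.finrank E (𝔅.filD ρ i)}.Finite
  then ∑ i ∈ h.toFinset,
    Multiset.replicate (Module.finrank E (𝔅.filD ρ i) - Module.finrank E (𝔅.filD ρ (i + 1))) i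
  else 0

end Admissible

end PeriodRingData

/-! ### Crystalline and semistable data -/

section Crystalline

variable (P : Type v) (F : Type v') [Field P] [Field F] [Algebra P F]

/-- A **crystalline period-ring datum** for the `p`-adic field `F` over `P` (playing `ℚ_p`):
a subfield `F₀` (playing the maximal absolutely unramified subfield `W(k)[1/p]`, supplied as
data), a period-ring datum over `F₀` for `Γ_F = Field.absoluteGaloisGroup F` — so that
`B^{Γ_F} = F₀`, as for `B_cris` — and a `Γ_F`-equivariant `P`-algebra endomorphism `frob`
(the Frobenius `φ`, semilinear over `F₀`, hence only `P`-linear).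
Ref: Fontaine, Astérisque 223 (1994), Exposé II §2.3, §4 (`B_cris`, `φ`), Exposé III §5.1
(`B_cris` is `(ℚ_p, G_K)`-regular with invariants `K₀`). [folklore] -/
structure CrystallinePeriodRingData : Type (max v v' (w + 1)) where
  /-- The subfield `F₀ ⊆ F` of invariants (`= W(k)[1/p]` for `B_cris`). -/
  F₀ : IntermediateField P F
  /-- The underlying period-ring datum, an `F₀`-algebra with `Γ_F`-action and `B^{Γ_F} = F₀`. -/
  toPeriodRingData : PeriodRingData.{v', v, v', w} (absoluteGaloisGroup F) P F₀
  /-- The Frobenius `φ : B → B`, a `P`-algebra endomorphism. -/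
  frob : toPeriodRingData.B →ₐ[P] toPeriodRingData.B
  /-- `φ` commutes with the Galois action. -/
  frob_smul : ∀ (σ : absoluteGaloisGroup F) (b : toPeriodRingData.B), frob (σ • b) = σ • frob b

/-- A **semistable period-ring datum** (for the prime `p`): a crystalline datum together with a
`Γ_F`-equivariant `P`-linear monodromy operator `N` with `N φ = p φ N`.
Ref: Fontaine, Astérisque 223 (1994), Exposé II §3 (`B_st`, `N`, `N φ = p φ N`), Exposé III
§5.1. [folklore] -/
structure SemistablePeriodRingData (p : ℕ) : Type (max v v' (w + 1))
    extends CrystallinePeriodRingData.{v, v', w} P F where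
  /-- The monodromy operator `N : B → B`. -/
  N : toPeriodRingData.B →ₗ[P] toPeriodRingData.B
  /-- `N` commutes with the Galois action. -/
  N_smul : ∀ (σ : absoluteGaloisGroup F) (b : toPeriodRingData.B), N (σ • b) = σ • N b
  /-- `N φ = p φ N`. -/
  N_comp_frob : N ∘ₗ frob.toLinearMap = (p : P) • (frob.toLinearMap ∘ₗ N)

end Crystalline

/-! ### The `p`-adic Hodge-theoretic adjectives for local Galois representations -/

namespace GaloisRep

section Local

variable {P : Type v} {F : Type v'} [Field P] [TopologicalSpace P] [Field F] [Algebra P F]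
  {M : Type w'} [AddCommGroup M] [Module P M] [TopologicalSpace M]

/-- `ρ : Γ_F → GL(M)` is **de Rham** relative to the period-ring datum `𝔅` (intended: `B_dR`
with its `t`-adic filtration): `dim_F (B ⊗_{ℚ_p} M)^{Γ_F} = dim_{ℚ_p} M`.
Ref: Fontaine, Astérisque 223 (1994), Exposé III §1.5, §3 (`B_dR`-admissible = de Rham). [folklore] -/
abbrev IsDeRham (𝔅 : PeriodRingData.{v', v, v', w} (absoluteGaloisGroup F) P F)
    (ρ : GaloisRep F P M) : Prop :=
  𝔅.IsAdmissible ρ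

/-- `ρ` is **Hodge–Tate** relative to `𝔅` (intended: the graded ring `B_HT = ⊕_i ℂ_p(i)` with
`Fil^i = ⊕_{j ≥ i}`): `dim_F (B_HT ⊗ M)^{Γ_F} = dim_{ℚ_p} M`.  Same shape as `IsDeRham`.
Ref: Fontaine, Astérisque 223 (1994), Exposé III §1.5, §2 (Hodge–Tate). [folklore] -/
abbrev IsHodgeTate (𝔅 : PeriodRingData.{v', v, v', w} (absoluteGaloisGroup F) P F)
    (ρ : GaloisRep F P M) : Prop :=
  𝔅.IsAdmissible ρ

/-- `ρ` is **crystalline** relative to the crystalline datum `𝔅` (intended: `B_cris`):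
`dim_{F₀} (B_cris ⊗ M)^{Γ_F} = dim_{ℚ_p} M`.
Ref: Fontaine, Astérisque 223 (1994), Exposé III §5.1. [folklore] -/
abbrev IsCrystalline (𝔅 : CrystallinePeriodRingData.{v, v', w} P F) (ρ : GaloisRep F P M) :
    Prop :=
  𝔅.toPeriodRingData.IsAdmissible ρ

/-- `ρ` is **semistable** relative to the semistable datum `𝔅` (intended: `B_st`):
`dim_{F₀} (B_st ⊗ M)^{Γ_F} = dim_{ℚ_p} M`.
Ref: Fontaine, Astérisque 223 (1994), Exposé III §5.1. [folklore] -/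
abbrev IsSemistable {p : ℕ} (𝔅 : SemistablePeriodRingData.{v, v', w} P F p)
    (ρ : GaloisRep F P M) : Prop :=
  𝔅.toPeriodRingData.IsAdmissible ρ

/-- `ρ` is **Hodge–Tate regular** relative to `𝔅` (intended: `B_dR` or `B_HT`): its Hodge–Tate
weights are pairwise distinct (`Multiset.Nodup`).
Ref: Buzzard–Gee (2014), Def. 3.1.1 footnote / §2.2 ("regular": distinct Hodge–Tate weights). [cite: BuzzardGee2014] -/
def IsHodgeTateRegular (𝔅 : PeriodRingData.{v', v, v', w} (absoluteGaloisGroup F) P F)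
    (ρ : GaloisRep F P M) : Prop :=
  (𝔅.hodgeTateWeights ρ).Nodup

/-- Unfolding lemma: `IsCrystalline` is admissibility (over `F₀`) for the underlying period-ring
datum. [folklore] -/
lemma isCrystalline_iff (𝔅 : CrystallinePeriodRingData.{v, v', w} P F) (ρ : GaloisRep F P M) :
    ρ.IsCrystalline 𝔅 ↔ 𝔅.toPeriodRingData.IsAdmissible ρ := Iff.rfl

end Local

/-! ### Geometric Galois representations of number fields (Fontaine–Mazur) -/

section Global

variable {K : Type u} [Field K] [NumberField K] {ℓ : ℕ} [Fact ℓ.Prime]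
  {M : Type w'} [AddCommGroup M] [Module ℚ_[ℓ] M] [TopologicalSpace M]

/-- `ρ : Γ_K → GL(M)` (`K` a number field, `M` a `ℚ_ℓ`-vector space) is **geometric** in the
sense of Fontaine–Mazur, relative to period-ring data `𝔅 v` at the places `v ∣ ℓ` (intended:
`B_dR` of `K_v`): `ρ` is unramified at all but finitely many places and `ρ|_{Γ_{K_v}}`
(`GaloisRep.toLocal`) is de Rham for every `v ∣ ℓ`.  Since Mathlib has no
`Algebra ℚ_[ℓ] (v.adicCompletion K)` instance, that structure is part of the datum `𝔅 v h`.
Per OUTLINE D1, consumers instantiate with `[IsModuleTopology ℚ_[ℓ] M]`.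
Ref: Fontaine–Mazur, *Geometric Galois representations* (1995), §1 (Definition, Conjecture 1). [folklore] -/
def IsGeometric
    (𝔅 : ∀ v : HeightOneSpectrum (𝓞 K), ((ℓ : ℕ) : 𝓞 K) ∈ v.asIdeal →
      Σ' (_ : Algebra ℚ_[ℓ] (v.adicCompletion K)),
        PeriodRingData.{u, 0, u, w} (absoluteGaloisGroup (v.adicCompletion K)) ℚ_[ℓ]
          (v.adicCompletion K))
    (ρ : GaloisRep K ℚ_[ℓ] M) : Prop :=
  ρ.IsUnramifiedAE ∧
    ∀ (v : HeightOneSpectrum (𝓞 K)) (h : ((ℓ : ℕ) : 𝓞 K) ∈ v.asIdeal),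
      letI := (𝔅 v h).1; (ρ.toLocal v).IsDeRham (𝔅 v h).2

end Global

end GaloisRep

end Literature.NumberTheory.GaloisRepresentations
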